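import Summits.NavierStokesRegularity.NavierStokesRegularity.Theorems.SqueezeCycleSingularZoomData
import Summits.NavierStokesRegularity.NavierStokesRegularity.Theorems.TypeILiouvilleTypeIliouvilleNoTypeIIStubActiveWindowsRegularity
import Literature.Analysis.FluidPDE.NSBoundedMildSmoothing
import HarnessLib

/-!
# Route `RootDecompLiouvilleHorizon`, support CPT `HorizonCompactness` (item stmt-NavierStokesRegularity-32320) —
# TOOLS: calculus lemmas, time translation and uniform end-of-window bounds for bounded Oseen-mild fields,
# and the normalised zoom about an interior time of a Clay-class solution

Part A (calculus, [folklore]): `‖Df − Dg‖ ≤ ‖D¹f − D¹g‖`; spatial Lipschitz bound of the gradient from a `D²`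
bound; the first-order Taylor LOWER bound `h‖Df(0)e‖ − Kh² ≤ ‖f(he) − f(0)‖`; a unit direction of near-maximal
stretch of a linear map; extension of a time-Lipschitz bound to the final time by one-sided continuity.
Part B (KNSS 2009 §4 through the tree's `TypeIliouvilleNoTypeII.ImmortalZoom.exists_norm_iteratedFDeriv_le_of_bounded`
/ `exists_lipschitz_time_of_bounded`): time translation of a continuous, weakly divergence-free, Oseen-mild,
bounded field on a window (`oseenDuhamel_translate`), and — by translating so that the fixed estimate window
`[−2, 0) ⊂ (−3, B)` of those theorems slides to the END of the given window — constants `K, L ≥ 0` with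
`‖D²v(σ)‖ ≤ K`, `‖Dv(σ)(x) − Dv(σ')(x)‖ ≤ L|σ − σ'|` for all `σ, σ' ∈ [−1, 0)` and every such field on `(A, 0)`,
`A ≤ −4`, bounded by `1` (`exists_uniform_end_bounds`).
Part C (the tree's `zoom_continuousOn` / `zoom_isWeaklyDivFree` / `zoom_oseen` / `zoom_isClassical` with `c = 1`):
the normalised zoom `v = α • stPull β R t y u` (`R = ν/M`, `α = R/ν = 1/M`, `β = R²/ν = ν/M²`) of a classical
solution on `[0, T)`, Leray–Hopf from rapidly decaying data, bounded by `M > 0` on `(0, t]`, `0 < t < T`, is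
continuous, weakly divergence free, Oseen-mild (unit viscosity) and bounded by `1` on `(−tM²/ν, 0)`, has smooth
slices there, `‖∇v(0)(0)‖ = (ν/M²)‖∇u(t)(y)‖`, and `σ ↦ ∇v(σ)(0)` is continuous at `σ = 0` (interior time).

Def-free; axioms ⊆ {propext, Classical.choice, Quot.sound}. Used by
`Theorems/RootDecompLiouvilleHorizonHorizonCompactness.lean` (`horizonCompactness_proof`).
Sources: [KochNadirashviliSereginSverak2009] arXiv:0709.3599 §1 (1.2), §4 (4.10)–(4.11), §6.
Lens provenance: decomp-ns lens 5, gen 22 (HOME/decomp-ns-lens-5/NODE-g22.md §4a).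
-/

set_option linter.dupNamespace false

noncomputable section

open MeasureTheory Set Function Filter TopologicalSpace Metric
open scoped Topology ContDiff

namespace Summit.NavierStokesRegularity.NavierStokesRegularity.Theorems.RootDecompLiouvilleHorizonHorizonCompactnessTools

open Literature.Analysis Literature.Analysis.FluidPDE
open Summit.NavierStokesRegularity.NavierStokesRegularity.Theorems

/-! ### A. Calculus lemmas -/

/-- `‖Df(x) − Dg(x)‖ ≤ ‖D¹f(x) − D¹g(x)‖` (the first iterated derivative is the derivative read
as a `1`-multilinear map). [folklore] -/
theorem norm_fderiv_sub_le_norm_iteratedFDeriv_one_sub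
    (f g : EuclideanSpace ℝ (Fin 3) → EuclideanSpace ℝ (Fin 3)) (x : EuclideanSpace ℝ (Fin 3)) :
    ‖fderiv ℝ f x - fderiv ℝ g x‖ ≤ ‖iteratedFDeriv ℝ 1 f x - iteratedFDeriv ℝ 1 g x‖ := by
  refine ContinuousLinearMap.opNorm_le_bound _ (norm_nonneg _) fun e => ?_
  have h := ContinuousMultilinearMap.le_opNorm (iteratedFDeriv ℝ 1 f x - iteratedFDeriv ℝ 1 g x)
    (fun _ => e)
  simpa only [sub_apply, iteratedFDeriv_one_apply, Finset.prod_const, Finset.card_univ,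
    Fintype.card_fin, pow_one] using h

/-- **Spatial Lipschitz bound of the gradient from a bound on the second derivative**:
`‖Df(y) − Df(z)‖ ≤ K‖y − z‖` if `f` is `C²` with `‖D²f‖ ≤ K` everywhere. [folklore] -/
theorem norm_fderiv_sub_le_of_iteratedFDeriv_two
    {f : EuclideanSpace ℝ (Fin 3) → EuclideanSpace ℝ (Fin 3)} (hf : ContDiff ℝ 2 f) {K : ℝ}
    (hK : ∀ y, ‖iteratedFDeriv ℝ 2 f y‖ ≤ K) (y z : EuclideanSpace ℝ (Fin 3)) :
    ‖fderiv ℝ f y - fderiv ℝ f z‖ ≤ K * ‖y - z‖ := by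
  have hd : ContDiff ℝ 1 (fderiv ℝ f) := hf.fderiv_right (m := 1) (by norm_num)
  have hdiff : ∀ w ∈ (univ : Set (EuclideanSpace ℝ (Fin 3))), DifferentiableAt ℝ (fderiv ℝ f) w :=
    fun w _ => (hd.differentiable (by simp)) w
  have hbd : ∀ w ∈ (univ : Set (EuclideanSpace ℝ (Fin 3))), ‖fderiv ℝ (fderiv ℝ f) w‖ ≤ K := by
    intro w _
    rw [← norm_iteratedFDeriv_zero (𝕜 := ℝ) (f := fderiv ℝ (fderiv ℝ f)), norm_iteratedFDeriv_fderiv,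
      norm_iteratedFDeriv_fderiv]
    exact hK w
  exact (convex_univ.norm_image_sub_le_of_norm_fderiv_le hdiff hbd (mem_univ z) (mem_univ y))

/-- **First-order Taylor lower bound**: if `f` is differentiable with `‖Df(y) − Df(0)‖ ≤ K‖y‖`,
then `h‖Df(0)e‖ − K h² ≤ ‖f(h e) − f(0)‖` for `h > 0`, `‖e‖ ≤ 1`. [folklore] -/
theorem taylor_lower_bound {f : EuclideanSpace ℝ (Fin 3) → EuclideanSpace ℝ (Fin 3)}
    (hf : Differentiable ℝ f) {K : ℝ} (hK : 0 ≤ K)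
    (hLip : ∀ y, ‖fderiv ℝ f y - fderiv ℝ f 0‖ ≤ K * ‖y‖) {h : ℝ} (hh : 0 < h)
    {e : EuclideanSpace ℝ (Fin 3)} (he : ‖e‖ ≤ 1) :
    h * ‖fderiv ℝ f 0 e‖ - K * h ^ 2 ≤ ‖f (h • e) - f 0‖ := by
  set A : EuclideanSpace ℝ (Fin 3) →L[ℝ] EuclideanSpace ℝ (Fin 3) := fderiv ℝ f 0 with hA
  set φ : EuclideanSpace ℝ (Fin 3) → EuclideanSpace ℝ (Fin 3) := fun y => f y - A y with hφ
  have hφd : ∀ y, DifferentiableAt ℝ φ y := fun y => (hf y).sub A.differentiableAt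
  have hφD : ∀ y, fderiv ℝ φ y = fderiv ℝ f y - A := fun y =>
    ((hf y).hasFDerivAt.sub A.hasFDerivAt).fderiv
  have hhe : ‖h • e‖ ≤ h := by
    rw [norm_smul, Real.norm_eq_abs, abs_of_pos hh]
    exact mul_le_of_le_one_right hh.le he
  have hbound : ∀ y ∈ closedBall (0 : EuclideanSpace ℝ (Fin 3)) h, ‖fderiv ℝ φ y‖ ≤ K * h := by
    intro y hy
    rw [hφD]
    exact (hLip y).trans (mul_le_mul_of_nonneg_left (mem_closedBall_zero_iff.1 hy) hK)
  have hMV := (convex_closedBall (0 : EuclideanSpace ℝ (Fin 3)) h).norm_image_sub_le_of_norm_fderiv_le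
    (fun y _ => hφd y) hbound (mem_closedBall_self hh.le) (mem_closedBall_zero_iff.2 hhe)
  rw [sub_zero] at hMV
  have hMV' : ‖φ (h • e) - φ 0‖ ≤ K * h ^ 2 := by
    refine hMV.trans ?_
    calc K * h * ‖h • e‖ ≤ K * h * h := mul_le_mul_of_nonneg_left hhe (mul_nonneg hK hh.le)
      _ = K * h ^ 2 := by ring
  have hid : φ (h • e) - φ 0 = (f (h • e) - f 0) - h • A e := by
    simp only [hφ, map_smul, map_zero, sub_zero]
    abel
  rw [hid] at hMV'
  have hn : h * ‖A e‖ = ‖h • A e‖ := by rw [norm_smul, Real.norm_eq_abs, abs_of_pos hh]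
  have htri : ‖h • A e‖ ≤ ‖f (h • e) - f 0‖ + ‖(f (h • e) - f 0) - h • A e‖ := by
    have := norm_sub_le (f (h • e) - f 0) ((f (h • e) - f 0) - h • A e)
    rwa [sub_sub_cancel] at this
  linarith

/-- **A direction of near-maximal stretch**: for `0 ≤ r < ‖A‖` there is a unit vector `e` with
`r < ‖A e‖`. [folklore] -/
theorem exists_unit_lt_norm_apply
    (A : EuclideanSpace ℝ (Fin 3) →L[ℝ] EuclideanSpace ℝ (Fin 3)) {r : ℝ} (hr0 : 0 ≤ r)
    (hr : r < ‖A‖) : ∃ e : EuclideanSpace ℝ (Fin 3), ‖e‖ = 1 ∧ r < ‖A e‖ := by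
  by_contra hne
  push Not at hne
  have hle : ‖A‖ ≤ r := by
    refine ContinuousLinearMap.opNorm_le_bound A hr0 fun x => ?_
    by_cases hx : x = 0
    · simp [hx]
    · have hxn : 0 < ‖x‖ := norm_pos_iff.2 hx
      have he : ‖(‖x‖⁻¹ : ℝ) • x‖ = 1 := by
        rw [norm_smul, norm_inv, norm_norm, inv_mul_cancel₀ hxn.ne']
      have h1 := hne _ he
      rw [map_smul, norm_smul, norm_inv, norm_norm, inv_mul_le_iff₀ hxn] at h1
      linarith [h1]
  exact absurd hr (not_lt.2 hle)

/-- **Extending a time-Lipschitz bound to the final time by one-sided continuity.** [folklore] -/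
theorem norm_sub_le_of_lipschitz_of_tendsto
    {D : ℝ → (EuclideanSpace ℝ (Fin 3) →L[ℝ] EuclideanSpace ℝ (Fin 3))} {L σ : ℝ}
    (hσ : σ ∈ Ico (-1 : ℝ) 0)
    (hLip : ∀ σ ∈ Ico (-1 : ℝ) 0, ∀ σ' ∈ Ico (-1 : ℝ) 0, ‖D σ - D σ'‖ ≤ L * |σ - σ'|)
    (hcont : Tendsto D (𝓝[<] 0) (𝓝 (D 0))) : ‖D σ - D 0‖ ≤ L * |σ| := by
  have h1 : Tendsto (fun σ' => ‖D σ - D σ'‖) (𝓝[<] 0) (𝓝 ‖D σ - D 0‖) :=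
    (tendsto_const_nhds.sub hcont).norm
  have h2 : Tendsto (fun σ' : ℝ => L * |σ - σ'|) (𝓝[<] 0) (𝓝 (L * |σ|)) := by
    have hc : Continuous fun σ' : ℝ => L * |σ - σ'| := by fun_prop
    have := hc.tendsto 0
    rw [sub_zero] at this
    exact this.mono_left nhdsWithin_le_nhds
  have h3 : ∀ᶠ σ' in 𝓝[<] (0 : ℝ), ‖D σ - D σ'‖ ≤ L * |σ - σ'| := by
    filter_upwards [Ioo_mem_nhdsLT (show (-1 : ℝ) < 0 by norm_num)] with σ' hσ'
    exact hLip σ hσ σ' ⟨hσ'.1.le, hσ'.2⟩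
  exact le_of_tendsto_of_tendsto h1 h2 h3

/-! ### B. Continuous bounded Oseen-mild fields on a window: translation and uniform bounds -/

section Window

variable {A B N c : ℝ} {v : ℝ → EuclideanSpace ℝ (Fin 3) → EuclideanSpace ℝ (Fin 3)}

/-- **Time translation** of a continuous bounded Oseen-mild field on `(A, B)`: `τ ↦ v(τ + c)` is
one on `(A − c, B − c)` (`oseenDuhamel_translate`). [folklore] -/
theorem window_translate (hc : ContinuousOn (uncurry v) (Ioo A B ×ˢ univ))
    (hdiv : ∀ t ∈ Ioo A B, IsWeaklyDivFree (v t))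
    (hmild : ∀ s t : ℝ, A < s → s < t → t < B → ∀ x,
      v t x = UnboundedOperators.heatExtension (v s) (t - s) x - oseenDuhamel 1 s v v t x)
    (hbd : ∀ t ∈ Ioo A B, ∀ x, ‖v t x‖ ≤ N) (c : ℝ) :
    ContinuousOn (uncurry fun τ => v (τ + c)) (Ioo (A - c) (B - c) ×ˢ univ) ∧
    (∀ t ∈ Ioo (A - c) (B - c), IsWeaklyDivFree ((fun τ => v (τ + c)) t)) ∧
    (∀ s t : ℝ, A - c < s → s < t → t < B - c → ∀ x,
      (fun τ => v (τ + c)) t x =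
        UnboundedOperators.heatExtension ((fun τ => v (τ + c)) s) (t - s) x -
          oseenDuhamel 1 s (fun τ => v (τ + c)) (fun τ => v (τ + c)) t x) ∧
    (∀ t ∈ Ioo (A - c) (B - c), ∀ x, ‖(fun τ => v (τ + c)) t x‖ ≤ N) := by
  have hI : ∀ t ∈ Ioo (A - c) (B - c), t + c ∈ Ioo A B := fun t ht =>
    ⟨by linarith [ht.1], by linarith [ht.2]⟩
  refine ⟨?_, fun t ht => hdiv _ (hI t ht), fun s t hs hst ht x => ?_, fun t ht x => hbd _ (hI t ht) x⟩
  · have hmap : Continuous fun p : ℝ × EuclideanSpace ℝ (Fin 3) => (p.1 + c, p.2) := by fun_prop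
    have hinto : MapsTo (fun p : ℝ × EuclideanSpace ℝ (Fin 3) => (p.1 + c, p.2))
        (Ioo (A - c) (B - c) ×ˢ univ) (Ioo A B ×ˢ univ) := by
      rintro ⟨t, x⟩ ⟨ht, -⟩
      exact ⟨hI t ht, mem_univ _⟩
    exact (hc.comp hmap.continuousOn hinto).congr fun p _ => rfl
  · rw [oseenDuhamel_translate]
    have h := hmild (s + c) (t + c) (by linarith) (by linarith) (by linarith) x
    rwa [show t + c - (s + c) = t - s by ring] at h

end Window

/-- **Uniform bounds near the end of the window** (KNSS 2009, (4.10)–(4.11), through the tree's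
uniform window bounds `exists_norm_iteratedFDeriv_le_of_bounded` /
`exists_lipschitz_time_of_bounded`, applied to time translates): there are `K, L ≥ 0` such that
every continuous Oseen-mild field on `(A, 0)`, `A ≤ −4`, bounded by `1`, has `‖D²v(σ)‖ ≤ K` and
`‖Dv(σ)(x) − Dv(σ')(x)‖ ≤ L|σ − σ'|` for `σ, σ' ∈ [−1, 0)`. [cite: KochNadirashviliSereginSverak2009, §4 (4.10)–(4.11) (arXiv:0709.3599v1 p. 8)] -/
theorem exists_uniform_end_bounds :
    ∃ K L : ℝ, 0 ≤ K ∧ 0 ≤ L ∧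
      ∀ ⦃A : ℝ⦄ ⦃v : ℝ → EuclideanSpace ℝ (Fin 3) → EuclideanSpace ℝ (Fin 3)⦄, A ≤ -4 →
        ContinuousOn (uncurry v) (Ioo A 0 ×ˢ univ) →
        (∀ t ∈ Ioo A 0, IsWeaklyDivFree (v t)) →
        (∀ s t : ℝ, A < s → s < t → t < 0 → ∀ x,
          v t x = UnboundedOperators.heatExtension (v s) (t - s) x - oseenDuhamel 1 s v v t x) →
        (∀ t ∈ Ioo A 0, ∀ x, ‖v t x‖ ≤ 1) →
        (∀ σ ∈ Ico (-1 : ℝ) 0, ∀ x, ‖iteratedFDeriv ℝ 2 (v σ) x‖ ≤ K) ∧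
        (∀ σ ∈ Ico (-1 : ℝ) 0, ∀ σ' ∈ Ico (-1 : ℝ) 0, ∀ x,
          ‖fderiv ℝ (v σ) x - fderiv ℝ (v σ') x‖ ≤ L * |σ - σ'|) := by
  obtain ⟨K, hK⟩ := TypeIliouvilleNoTypeII.ImmortalZoom.exists_norm_iteratedFDeriv_le_of_bounded
    (1 : ℝ) 2 (a := -3) (b := 0) (δ := 1) (by norm_num) one_pos
  obtain ⟨L, hL0, hL⟩ := TypeIliouvilleNoTypeII.ImmortalZoom.exists_lipschitz_time_of_bounded
    (1 : ℝ) 1 (a := -3) (b := 0) (δ := 1) (by norm_num) one_pos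
  refine ⟨max K 0, L, le_max_right _ _, hL0, fun A v hA hc hdiv hmild hbd => ⟨?_, ?_⟩⟩
  · intro σ hσ x
    -- translate by `c = σ/2`: the translate lives on `(A − σ/2, −σ/2) ⊇ [-3, 0]`
    obtain ⟨hc', hdiv', hmild', hbd'⟩ := window_translate hc hdiv hmild hbd (σ / 2)
    have h := hK (A := A - σ / 2) (B := 0 - σ / 2) (by linarith [hσ.1]) (by linarith [hσ.2])
      hc' hdiv' hmild' hbd' (σ / 2) ⟨by linarith [hσ.1], by linarith [hσ.2]⟩ x
    rw [add_halves] at h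
    exact h.trans (le_max_left _ _)
  · intro σ hσ σ' hσ' x
    -- translate by `c = m/2`, `m = max σ σ'`
    set m : ℝ := max σ σ' with hm
    have hmσ : σ ≤ m := le_max_left _ _
    have hmσ' : σ' ≤ m := le_max_right _ _
    have hm0 : m < 0 := max_lt hσ.2 hσ'.2
    have hm1 : -1 ≤ m := hσ.1.trans hmσ
    obtain ⟨hc', hdiv', hmild', hbd'⟩ := window_translate hc hdiv hmild hbd (m / 2)
    have h := hL (A := A - m / 2) (B := 0 - m / 2) (by linarith) (by linarith)
      hc' hdiv' hmild' hbd' (σ' - m / 2) ⟨by linarith [hσ'.1], by linarith⟩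
      (σ - m / 2) ⟨by linarith [hσ.1], by linarith⟩ x
    rw [sub_add_cancel, sub_add_cancel, show σ - m / 2 - (σ' - m / 2) = σ - σ' by ring] at h
    exact (norm_fderiv_sub_le_norm_iteratedFDeriv_one_sub _ _ x).trans h


/-! ### C. The normalised zoom about an interior time of a Clay-class solution -/

section Zoom

variable {ν T t M R α β : ℝ} {u : ℝ → EuclideanSpace ℝ (Fin 3) → EuclideanSpace ℝ (Fin 3)}
  {p : ℝ → EuclideanSpace ℝ (Fin 3) → ℝ} {y : EuclideanSpace ℝ (Fin 3)}

/-- **The normalised zoom on its window** (KNSS 2009, §6: rescale to `M = ν = 1`): for a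
classical solution on `[0, T)`, Leray–Hopf from its rapidly decaying datum, a time `0 < t < T` and
a bound `‖u‖ ≤ M` on `(0, t] × ℝ³`, `M > 0`, the field `v(s, z) = M⁻¹ u(t + (ν/M²)s, y + (ν/M)z)`
(`α • stPull β R t y u`, `R = ν/M`, `α = R/ν`, `β = R²/ν`) is, on the window `(−tM²/ν, 0)`,
continuous, weakly divergence free, Oseen-mild (unit viscosity) and bounded by `1`
(the tree's `zoom_continuousOn`, `zoom_isWeaklyDivFree`, `zoom_oseen` with `c = 1`). [cite: KochNadirashviliSereginSverak2009, §1 (1.2) and §6 (arXiv:0709.3599 pp. 2, 13)] -/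
theorem zoomN_window (hν : 0 < ν) (hsol : IsClassicalNSSolutionOn (Ico 0 T) ν 0 u p)
    (hLH : IsLerayHopfOn T ν 0 (u 0) u) (hdec : HasRapidSpatialDecay (u 0)) (ht : t ∈ Ioo 0 T)
    (hM : 0 < M) (hbd : ∀ s ∈ Ioc 0 t, ∀ z, ‖u s z‖ ≤ M) (hR : R = ν / M) (hα : α = R / ν)
    (hβ : β = R ^ 2 / ν) :
    ContinuousOn (uncurry (α • stPull β R t y u)) (Ioo (-(t / β)) 0 ×ˢ univ) ∧
    (∀ s ∈ Ioo (-(t / β)) 0, IsWeaklyDivFree ((α • stPull β R t y u) s)) ∧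
    (∀ σ τ : ℝ, -(t / β) < σ → σ < τ → τ < 0 → ∀ z,
      (α • stPull β R t y u) τ z =
        UnboundedOperators.heatExtension ((α • stPull β R t y u) σ) (τ - σ) z -
          oseenDuhamel 1 σ (α • stPull β R t y u) (α • stPull β R t y u) τ z) ∧
    (∀ s ∈ Ioo (-(t / β)) 0, ∀ z, ‖(α • stPull β R t y u) s z‖ ≤ 1) := by
  have hR0 : 0 < R := by rw [hR]; positivity
  have hβ0 : 0 < β := by rw [hβ]; positivity
  have hα0 : 0 < α := by rw [hα]; positivity
  have hsol' : IsClassicalNSSolutionOn (Ico 0 t) ν 0 u p :=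
    hsol.mono (Ico_subset_Ico_right ht.2.le) (uniqueDiffOn_Ico 0 t)
  have hLH' : IsLerayHopfOn t ν 0 (u 0) u := hLH.of_le ht.2.le
  refine ⟨?_, fun s hs => ?_, fun σ τ hσ hστ hτ z => ?_, fun s hs z => ?_⟩
  · simpa only [one_mul, one_pow] using
      zoom_continuousOn (x₀ := y) hν hsol' hR0 hα hβ one_pos le_rfl
  · have hs' : s ∈ Ioo (-(t / (1 ^ 2 * β))) 0 := by simpa only [one_pow, one_mul] using hs
    simpa only [one_mul, one_pow] using
      zoom_isWeaklyDivFree (x₀ := y) hν hsol' hR0 hα hβ one_pos le_rfl hs'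
  · have hσ' : -(t / (1 ^ 2 * β)) < σ := by simpa only [one_pow, one_mul] using hσ
    simpa only [one_mul, one_pow] using
      zoom_oseen (x₀ := y) hν ht.1 hsol' hLH' hdec hR0 hα hβ one_pos le_rfl hσ' hστ hτ z
  · have hs' : s ∈ Ioo (-(t / (1 ^ 2 * β))) 0 := by simpa only [one_pow, one_mul] using hs
    obtain ⟨hmem, -⟩ := Theorems.zoom_time_mem (T := t) one_pos hβ0 le_rfl hs'
    rw [one_pow, one_mul, sub_self] at hmem
    rw [smul_stPull_apply, norm_smul, Real.norm_eq_abs, abs_of_pos hα0]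
    have hαM : α * M = 1 := by rw [hα, hR]; field_simp
    calc α * ‖u (t + β * s) (y + R • z)‖ ≤ α * M :=
          mul_le_mul_of_nonneg_left (hbd _ ⟨hmem.1, hmem.2.le⟩ _) hα0.le
      _ = 1 := hαM

/-- **The slices of the normalised zoom are smooth** on the window. [folklore] -/
theorem zoomN_contDiff_slice (hν : 0 < ν) (hsol : IsClassicalNSSolutionOn (Ico 0 T) ν 0 u p)
    (ht : t ∈ Ioo 0 T) (hM : 0 < M) (hR : R = ν / M) (hα : α = R / ν) (hβ : β = R ^ 2 / ν)
    {s : ℝ} (hs : s ∈ Ioo (-(t / β)) 0) : ContDiff ℝ 2 ((α • stPull β R t y u) s) := by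
  have hR0 : 0 < R := by rw [hR]; positivity
  have hsol' : IsClassicalNSSolutionOn (Ico 0 t) ν 0 u p :=
    hsol.mono (Ico_subset_Ico_right ht.2.le) (uniqueDiffOn_Ico 0 t)
  have hs' : s ∈ Ioo (-(t / (1 ^ 2 * β))) 0 := by simpa only [one_pow, one_mul] using hs
  have h := (zoom_isClassical (x₀ := y) hν hsol' hR0 hα hβ one_pos le_rfl).contDiff_velocity hs'
  simpa only [one_mul, one_pow, Nat.cast_ofNat] using contDiff_infty.1 h 2

/-- **The gradient of the normalised zoom at the centre**:
`‖∇v(0)(0)‖ = (ν/M²)‖∇u(t)(y)‖` (chain rule). [folklore] -/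
theorem zoomN_norm_fderiv_centre (hν : 0 < ν) (hsol : IsClassicalNSSolutionOn (Ico 0 T) ν 0 u p)
    (ht : t ∈ Ioo 0 T) (hM : 0 < M) (hR : R = ν / M) (hα : α = R / ν) :
    ‖fderiv ℝ ((α • stPull β R t y u) 0) 0‖ = ν / M ^ 2 * ‖fderiv ℝ (u t) y‖ := by
  have hR0 : 0 < R := by rw [hR]; positivity
  have hα0 : 0 < α := by rw [hα]; positivity
  have hslice : (α • stPull β R t y u) 0 = fun z => α • u t (y + R • z) := by
    funext z
    rw [smul_stPull_apply, mul_zero, add_zero]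
  have hu1 : ContDiff ℝ 1 (u t) :=
    (hsol.contDiff_velocity ⟨ht.1.le, ht.2⟩).of_le (by exact_mod_cast le_top)
  have hud : HasFDerivAt (u t) (fderiv ℝ (u t) (y + R • (0 : EuclideanSpace ℝ (Fin 3))))
      (y + R • (0 : EuclideanSpace ℝ (Fin 3))) :=
    ((hu1.differentiable one_ne_zero) _).hasFDerivAt
  have hg : HasFDerivAt (fun z : EuclideanSpace ℝ (Fin 3) => y + R • z)
      (R • ContinuousLinearMap.id ℝ (EuclideanSpace ℝ (Fin 3))) 0 :=
    ((hasFDerivAt_id (0 : EuclideanSpace ℝ (Fin 3))).const_smul R).const_add y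
  have hcomp := (hud.comp (0 : EuclideanSpace ℝ (Fin 3)) hg).const_smul α
  rw [smul_zero, add_zero] at hcomp
  have hcomp' : HasFDerivAt (fun z : EuclideanSpace ℝ (Fin 3) => α • u t (y + R • z))
      (α • (fderiv ℝ (u t) y).comp (R • ContinuousLinearMap.id ℝ (EuclideanSpace ℝ (Fin 3)))) 0 :=
    hcomp
  rw [hslice, hcomp'.fderiv, ContinuousLinearMap.comp_smul, ContinuousLinearMap.comp_id, smul_smul,
    norm_smul, Real.norm_eq_abs, abs_of_pos (mul_pos hα0 hR0)]
  congr 1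
  rw [hα, hR]
  field_simp

/-- **The gradient of the normalised zoom at the spatial centre is continuous in time at the
centre time** (`0 < t < T`: the solution is jointly smooth about `(t, ·)`). [folklore] -/
theorem zoomN_continuousAt_fderiv (hsol : IsClassicalNSSolutionOn (Ico 0 T) ν 0 u p)
    (ht : t ∈ Ioo 0 T) :
    ContinuousAt (fun σ => fderiv ℝ ((α • stPull β R t y u) σ) 0) 0 := by
  set Φ : ℝ × EuclideanSpace ℝ (Fin 3) → ℝ × EuclideanSpace ℝ (Fin 3) :=
    fun q => (t + β * q.1, y + R • q.2) with hΦ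
  have hΦc : ContDiff ℝ 1 Φ := by
    rw [hΦ]
    fun_prop
  have hId : uncurry (α • stPull β R t y u) = fun q => α • (uncurry u ∘ Φ) q := by
    funext q
    rfl
  have hΦ0 : ∀ z : EuclideanSpace ℝ (Fin 3), Φ (0, z) = (t, y + R • z) := fun z => by
    simp [hΦ]
  have hnhds : ∀ z : EuclideanSpace ℝ (Fin 3),
      Ico 0 T ×ˢ (univ : Set (EuclideanSpace ℝ (Fin 3))) ∈ 𝓝 (Φ (0, z)) := fun z => by
    rw [hΦ0]
    exact mem_of_superset ((isOpen_Ioo.prod isOpen_univ).mem_nhds ⟨ht, mem_univ _⟩)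
      (prod_mono Ioo_subset_Ico_self subset_rfl)
  have hsm : ContDiffOn ℝ ∞ (uncurry u) (Ico 0 T ×ˢ (univ : Set (EuclideanSpace ℝ (Fin 3)))) :=
    hsol.smooth_velocity
  have hu : ∀ z : EuclideanSpace ℝ (Fin 3), ContDiffAt ℝ 1 (uncurry u) (Φ (0, z)) := fun z =>
    ((hsm.contDiffAt (hnhds z)).of_le (by exact_mod_cast le_top))
  have hv : ContDiffAt ℝ 1 (uncurry (α • stPull β R t y u)) ((0 : ℝ), (0 : EuclideanSpace ℝ (Fin 3))) := by
    rw [hId]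
    exact ((hu 0).comp ((0 : ℝ), (0 : EuclideanSpace ℝ (Fin 3))) hΦc.contDiffAt).const_smul α
  have h := ContDiffAt.fderiv (m := 0) (g := fun _ : ℝ => (0 : EuclideanSpace ℝ (Fin 3))) hv
    contDiffAt_const (by simp)
  exact h.continuousAt

end Zoom

end Summit.NavierStokesRegularity.NavierStokesRegularity.Theorems.RootDecompLiouvilleHorizonHorizonCompactnessTools

end
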